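import Mathlib
import Summits.ResolutionOfSingularities.ResolutionOfSingularities.Theorems.WeightedInvariantLocalWeightedDropTOT2ChartWeierstrassPair

/-!
# TOT2-LINE (P3) brick B4, kernel part 4: WEIERSTRASS ELEMENTS OF A ONE-DIMENSIONAL PRIME of `k⟦x,v,w⟧`

Sub-problem `ResolutionOfSingularities`, ENGINE crux `stmt-ResolutionOfSingularities-8899` (`LocalWeightedDrop`), skeleton v35
(2e806da509994632), registered stub `stub_conflictBudget` (P3), bricks B4-1 … B4-4 of `L/res-L1-w43-stub-2/g6/P3_split_v1.lean`.
[OURS · L1 W4.3 · chain w43 · res-L1-w43-lead-1 g6; def-free; nothing here is a statement of any manuscript; AI-produced,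
gate-checked, weaker than expert review.]

`exists_weierstrass_mem`: if `P′` is a prime of `R₃ = k⟦x,v,w⟧` (`x = X 0`) with `dim R₃⧸P′ = 1` and `x ∉ P′`, then for each other
variable `X s` (`s ≠ 0`) the prime `P′` contains a WEIERSTRASS ELEMENT `X s ^ α + Σ_{j<α} a_j(x) (X s)^j` with `a_j ∈ k⟦x⟧`,
`a_j(0) = 0`.  Proof: `R₃ ⧸ P′` is a finite `k⟦x⟧`-module (complete Nakayama, the tree's
`module_finite_of_isAdicComplete_of_residue_surjective`, since `(x̄)` is primary to the maximal ideal of the one-dimensional local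
domain `R₃ ⧸ P′`); so the class of `X s` satisfies a monic equation over `k⟦x⟧`; Weierstrass preparation in `k⟦x, T⟧`
(`WeierstrassForm.exists_weierstrass`) turns that monic polynomial into a unit times a Weierstrass polynomial.
-/

set_option linter.dupNamespace false -- mandated namespace of this single-conjunct summit

noncomputable section

namespace Summit.ResolutionOfSingularities.ResolutionOfSingularities.Theorems

namespace TOT2Chart

open MvPowerSeries IsLocalRing

variable {k : Type} [Field k]

/-! ## §1 Reading a polynomial over `k⟦x⟧` in `X s` as a two-variable series -/

/-- Killing every variable but `X 1` sends a series in `x = X 0` alone to its constant term (`k⟦x, T⟧`, `T = X 1`). -/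
theorem killCompl_two_rename_zero (r : MvPowerSeries (Fin 1) k) :
    killCompl (R := k) (⟨fun _ : Fin 1 => (1 : Fin 2), fun a b _ => Subsingleton.elim a b⟩ : Fin 1 ↪ Fin 2)
      (rename (fun _ : Fin 1 => (0 : Fin 2)) r) = C (constantCoeff r) := by
  have hdvd : (X 0 : MvPowerSeries (Fin 1) k) ∣ r - C (constantCoeff r) := by
    rw [X_dvd_iff]
    intro m hm
    have hm0 : m = 0 := Finsupp.ext fun i => by fin_cases i; simpa using hm
    rw [hm0, map_sub, coeff_zero_eq_constantCoeff, constantCoeff_C, sub_self]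
  obtain ⟨q, hq⟩ := hdvd
  have : r = C (constantCoeff r) + X 0 * q := by rw [← hq]; ring
  conv_lhs => rw [this]
  rw [map_add, map_mul, rename_C, rename_X, map_add, killCompl_C, map_mul,
    killCompl_X_eq_zero (by rintro ⟨u, hu⟩; exact one_ne_zero hu), zero_mul, add_zero]

/-- The pure `T`-coefficients of `Σ_i p_i(x) T^i` are the constant terms `p_i(0)`. -/
theorem coeff_single_eval₂ (p : Polynomial (MvPowerSeries (Fin 1) k)) (n : ℕ) :
    coeff (Finsupp.single (1 : Fin 2) n)
        (p.eval₂ (rename (fun _ : Fin 1 => (0 : Fin 2))).toRingHom (X 1) : MvPowerSeries (Fin 2) k) =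
      constantCoeff (p.coeff n) := by
  classical
  set κ := killCompl (R := k) (⟨fun _ : Fin 1 => (1 : Fin 2), fun a b _ => Subsingleton.elim a b⟩ : Fin 1 ↪ Fin 2) with hκ
  have hcoeff : coeff (Finsupp.single (1 : Fin 2) n) (p.eval₂ (rename (fun _ : Fin 1 => (0 : Fin 2))).toRingHom (X 1)) =
      coeff (Finsupp.single (0 : Fin 1) n) (κ (p.eval₂ (rename (fun _ : Fin 1 => (0 : Fin 2))).toRingHom (X 1))) := by
    rw [hκ, coeff_killCompl, Finsupp.embDomain_single]; rfl
  have hhom : κ (p.eval₂ (rename (fun _ : Fin 1 => (0 : Fin 2))).toRingHom (X 1)) =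
      p.eval₂ (κ.toRingHom.comp (rename (fun _ : Fin 1 => (0 : Fin 2))).toRingHom) (κ.toRingHom (X 1)) :=
    Polynomial.hom_eval₂ p _ κ.toRingHom (X 1)
  rw [hcoeff, hhom, Polynomial.eval₂_eq_sum_range, map_sum]
  have hX : κ.toRingHom (X 1 : MvPowerSeries (Fin 2) k) = X 0 := by
    rw [hκ]; exact killCompl_X (R := k) (e := (⟨fun _ : Fin 1 => (1 : Fin 2), fun a b _ => Subsingleton.elim a b⟩ : Fin 1 ↪ Fin 2)) 0
  have hterm : ∀ i, coeff (Finsupp.single (0 : Fin 1) n)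
      ((κ.toRingHom.comp (rename (fun _ : Fin 1 => (0 : Fin 2))).toRingHom) (p.coeff i) * κ.toRingHom (X 1) ^ i) =
      if i = n then constantCoeff (p.coeff n) else 0 := by
    intro i
    rw [hX, RingHom.comp_apply]
    change coeff _ (κ (rename (fun _ : Fin 1 => (0 : Fin 2)) (p.coeff i)) * X 0 ^ i) = _
    rw [killCompl_two_rename_zero, coeff_C_mul, coeff_X_pow]
    by_cases h : i = n
    · subst h; simp
    · rw [if_neg (fun h' => h (Finsupp.single_injective _ h').symm), if_neg h, mul_zero]
  simp_rw [hterm]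
  rw [Finset.sum_ite_eq' (Finset.range (p.natDegree + 1)) n]
  split_ifs with hn
  · rfl
  · rw [Polynomial.coeff_eq_zero_of_natDegree_lt (by simpa using hn), map_zero]

/-! ## §2 The branch ring is finite over `k⟦x⟧` -/

section Finite

variable (P : Ideal (MvPowerSeries (Fin 3) k)) [hP : P.IsPrime]

/-- **`R₃ ⧸ P′` IS A FINITE `k⟦x⟧`-MODULE** when `dim R₃⧸P′ = 1` and `x ∉ P′` (the algebra structure being `x ↦ X 0`):
complete Nakayama over `k⟦x⟧`, the ideal `(x̄)` being primary to the maximal ideal of the one-dimensional local domain `R₃ ⧸ P′`. -/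
theorem moduleFinite_quotient (hdim : ringKrullDim (MvPowerSeries (Fin 3) k ⧸ P) = 1) (hx : (X 0 : MvPowerSeries (Fin 3) k) ∉ P) :
    letI := ((Ideal.Quotient.mk P).comp (rename (fun _ : Fin 1 => (0 : Fin 3)) :
      MvPowerSeries (Fin 1) k →ₐ[k] MvPowerSeries (Fin 3) k).toRingHom).toAlgebra
    Module.Finite (MvPowerSeries (Fin 1) k) (MvPowerSeries (Fin 3) k ⧸ P) := by
  letI := ((Ideal.Quotient.mk P).comp (rename (fun _ : Fin 1 => (0 : Fin 3)) :
      MvPowerSeries (Fin 1) k →ₐ[k] MvPowerSeries (Fin 3) k).toRingHom).toAlgebra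
  haveI := TOT2Branch.isLocalRing_quotient P
  haveI := TOT2Branch.isNoetherianRing_quotient P
  haveI := TOT2Branch.isAdicComplete_quotient P
  haveI : IsAdicComplete (maximalIdeal (MvPowerSeries (Fin 1) k)) (MvPowerSeries (Fin 1) k) :=
    WeierstrassForm.isAdicComplete_maximalIdeal k 1
  have halg : ∀ r, algebraMap (MvPowerSeries (Fin 1) k) (MvPowerSeries (Fin 3) k ⧸ P) r =
      Ideal.Quotient.mk P (rename (fun _ : Fin 1 => (0 : Fin 3)) r) := fun r => rfl
  refine Literature.AlgebraicGeometry.Resolution.module_finite_of_isAdicComplete_of_residue_surjective ?_ ?_ ?_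
  · -- local
    rw [Ideal.map_le_iff_le_comap]
    intro r hr
    rw [Ideal.mem_comap, halg, IsLocalRing.mem_maximalIdeal, mem_nonunits_iff]
    rw [WeierstrassForm.mem_maximalIdeal_iff] at hr
    intro hu
    have hu' := (TOT2Branch.isUnit_mk_iff P hP.ne_top _).mp hu
    rw [isUnit_iff_constantCoeff, constantCoeff_rename, hr] at hu'
    exact not_isUnit_zero hu'
  · -- residue fields
    intro x
    obtain ⟨y, rfl⟩ := Ideal.Quotient.mk_surjective x
    obtain ⟨G, rfl⟩ := Ideal.Quotient.mk_surjective y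
    refine ⟨C (constantCoeff G), ?_⟩
    rw [RingHom.comp_apply, halg, rename_C]
    have key : Ideal.Quotient.mk P (C (constantCoeff G)) - Ideal.Quotient.mk P G ∈ maximalIdeal (MvPowerSeries (Fin 3) k ⧸ P) := by
      rw [← map_sub, IsLocalRing.mem_maximalIdeal, mem_nonunits_iff, TOT2Branch.isUnit_mk_iff P hP.ne_top, isUnit_iff_constantCoeff,
        map_sub, constantCoeff_C, sub_self]
      exact not_isUnit_zero
    exact Ideal.Quotient.eq.mpr key
  · -- `(x̄)` is `𝔪`-primary
    haveI : Ring.KrullDimLE 1 (MvPowerSeries (Fin 3) k ⧸ P) := Ring.krullDimLE_iff.mpr hdim.le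
    have hx0 : Ideal.Quotient.mk P (X 0) ≠ 0 := fun h => hx (Ideal.Quotient.eq_zero_iff_mem.mp h)
    have hle : maximalIdeal (MvPowerSeries (Fin 3) k ⧸ P) ≤ (Ideal.span {Ideal.Quotient.mk P (X 0)}).radical := by
      rw [Ideal.radical_eq_sInf]
      refine le_sInf fun Q ⟨hQ, hQp⟩ => ?_
      have hQne : Q ≠ ⊥ := fun h => hx0 (by
        have := hQ (Ideal.mem_span_singleton_self _)
        rw [h] at this
        exact this)
      haveI := hQp.isMaximal_of_ne_bot hQne
      exact (IsLocalRing.eq_maximalIdeal (inferInstance : Q.IsMaximal)).symm.le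
    obtain ⟨N, hN⟩ := Ideal.exists_pow_le_of_le_radical_of_fg hle (IsNoetherian.noetherian _)
    refine ⟨N, hN.trans ?_⟩
    rw [Ideal.span_singleton_le_iff_mem]
    have : Ideal.Quotient.mk P (X 0) = algebraMap (MvPowerSeries (Fin 1) k) (MvPowerSeries (Fin 3) k ⧸ P) (X 0) := by
      rw [halg, rename_X]
    rw [this]
    exact Ideal.mem_map_of_mem _ ((WeierstrassForm.mem_maximalIdeal_iff _).mpr (constantCoeff_X _))

end Finite

/-! ## §3 Weierstrass elements in a one-dimensional prime -/

/-- **WEIERSTRASS ELEMENTS OF A ONE-DIMENSIONAL PRIME.**  If `P′` is a prime of `k⟦x,v,w⟧` (`x = X 0`) with `dim R₃⧸P′ = 1` and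
`x ∉ P′`, then for every variable `X s` the prime contains `X s ^ α + Σ_{j<α} a_j(x)·(X s)^j` with `a_j ∈ k⟦x⟧`, `a_j(0) = 0`
(written with the spare factor `x^0` of the chart kernel's normal form). -/
theorem exists_weierstrass_mem (P : Ideal (MvPowerSeries (Fin 3) k)) [hP : P.IsPrime]
    (hdim : ringKrullDim (MvPowerSeries (Fin 3) k ⧸ P) = 1) (hx : (X 0 : MvPowerSeries (Fin 3) k) ∉ P) (s : Fin 3) :
    ∃ (α : ℕ) (av : Fin α → MvPowerSeries (Fin 1) k), (∀ j, constantCoeff (av j) = 0) ∧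
      X s ^ α + ∑ j, rename (fun _ : Fin 1 => (0 : Fin 3)) (av j) * X 0 ^ (0 : ℕ) * X s ^ (j : ℕ) ∈ P := by
  classical
  letI := ((Ideal.Quotient.mk P).comp (rename (fun _ : Fin 1 => (0 : Fin 3)) :
      MvPowerSeries (Fin 1) k →ₐ[k] MvPowerSeries (Fin 3) k).toRingHom).toAlgebra
  haveI := moduleFinite_quotient P hdim hx
  have halg : algebraMap (MvPowerSeries (Fin 1) k) (MvPowerSeries (Fin 3) k ⧸ P) =
      (Ideal.Quotient.mk P).comp (rename (fun _ : Fin 1 => (0 : Fin 3)) : MvPowerSeries (Fin 1) k →ₐ[k] MvPowerSeries (Fin 3) k).toRingHom :=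
    rfl
  -- a monic equation for the class of `X s`
  obtain ⟨p, hpm, hp0⟩ : IsIntegral (MvPowerSeries (Fin 1) k) (Ideal.Quotient.mk P (X s)) := IsIntegral.of_finite _ _
  set G : MvPowerSeries (Fin 3) k := p.eval₂ (rename (fun _ : Fin 1 => (0 : Fin 3))).toRingHom (X s) with hG
  have hGP : G ∈ P := by
    rw [← Ideal.Quotient.eq_zero_iff_mem, hG, Polynomial.hom_eval₂, ← halg]
    exact hp0
  -- the same polynomial read in `k⟦x, T⟧`
  set j₂ : Fin 2 → Fin 3 := ![0, s] with hj₂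
  set G₂ : MvPowerSeries (Fin 2) k := p.eval₂ (rename (fun _ : Fin 1 => (0 : Fin 2))).toRingHom (X 1) with hG₂
  have hG₂G : rename j₂ G₂ = G := by
    have hhom : rename j₂ G₂ = p.eval₂ ((rename j₂).toRingHom.comp (rename (fun _ : Fin 1 => (0 : Fin 2))).toRingHom)
        ((rename j₂).toRingHom (X 1)) := Polynomial.hom_eval₂ p _ (rename j₂).toRingHom (X 1)
    rw [hhom, hG]
    congr 1
    · ext r : 1
      change rename j₂ (rename (fun _ : Fin 1 => (0 : Fin 2)) r) = rename (fun _ : Fin 1 => (0 : Fin 3)) r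
      rw [rename_rename]
      rfl
    · change rename j₂ (X 1) = X s
      rw [rename_X]; rfl
  -- the first non-zero pure `T`-coefficient (the leading one is `1`)
  have hex : ∃ n, coeff (Finsupp.single (1 : Fin 2) n) G₂ ≠ 0 :=
    ⟨p.natDegree, by rw [hG₂, coeff_single_eval₂, Polynomial.coeff_natDegree, hpm.leadingCoeff, constantCoeff_one]; exact one_ne_zero⟩
  set d₀ := Nat.find hex
  have hlast : Fin.last 1 = (1 : Fin 2) := rfl
  obtain ⟨H, A, hH, hA, hfac⟩ := WeierstrassForm.exists_weierstrass (m := 1) (d := d₀) G₂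
    (fun n hn => by rw [hlast]; exact not_not.mp (Nat.find_min hex hn)) (by rw [hlast]; exact Nat.find_spec hex)
  refine ⟨d₀, A, hA, ?_⟩
  -- transport the factorisation to `k⟦x,v,w⟧` and strip the unit
  have hunit : IsUnit (rename j₂ H) := by
    rw [isUnit_iff_constantCoeff, constantCoeff_rename, isUnit_iff_ne_zero]; exact hH
  have hW : rename j₂ (X (Fin.last 1) ^ d₀ + ∑ j, rename (Fin.succAboveEmb (Fin.last 1)) (A j) * X (Fin.last 1) ^ (j : ℕ)) =
      X s ^ d₀ + ∑ j, rename (fun _ : Fin 1 => (0 : Fin 3)) (A j) * X 0 ^ (0 : ℕ) * X s ^ (j : ℕ) := by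
    rw [map_add, map_pow, rename_X, map_sum]
    have hs' : j₂ (Fin.last 1) = s := rfl
    rw [hs']
    have hcomp : (j₂ ∘ (Fin.succAboveEmb (Fin.last 1) : Fin 1 → Fin 2)) = fun _ : Fin 1 => (0 : Fin 3) :=
      funext fun i => by fin_cases i; rfl
    refine congrArg _ (Finset.sum_congr rfl fun j _ => ?_)
    rw [map_mul, map_pow, rename_X, hs', rename_rename, pow_zero, mul_one]
    simp only [hcomp]
  rw [← (Ideal.unit_mul_mem_iff_mem P hunit), ← hW, ← map_mul, ← hfac, hG₂G]
  exact hGP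

end TOT2Chart

end Summit.ResolutionOfSingularities.ResolutionOfSingularities.Theorems

end
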